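import Literature.AlgebraicGeometry.Resolution.AlterationsRationalMapExtensionProofs
import Literature.AlgebraicGeometry.Resolution.AlterationsStrictTransformConsequences
import Literature.AlgebraicGeometry.Resolution.AlterationsPreSemiStableToSemiStableProofs
import Literature.AlgebraicGeometry.Resolution.AlterationsMultisectionEtaleNhdProofs
import Literature.AlgebraicGeometry.Resolution.GaloisNormalizationHolds
import HarnessLib

/-!
# De Jong 1996, 4.15–4.22 (`DeJong1996MultisectionToSemiStablePair`) from its two open leaves

Topic: `Literature/AlgebraicGeometry/Resolution`. Bookkeeping (pure composition: no new named
fact, no new definition) for the named fact `DeJong1996MultisectionToSemiStablePair` of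
`AlterationsMultisection.lean` — de Jong 1996, 4.15–4.22: over an algebraically closed field `k`,
given Thm. 4.1 with its generically-étale clause in dimension `≤ d`, Thm. 4.1 with the clause for a
fibred pair `(X, Z)` with (i), (iii), (iv), (vi) a)–e) of dimension `d + 1` follows from Thm. 4.1
with the clause for every pair in Situation 4.23 over `k` of the same dimension.

D-0026 review of the cut (2026-08-15, with the held copy of the source open at pp. 71–75): the
statement is the printed block as stated — it starts where 4.16 starts ("4.16. Assume (i)–(iv),
(vi) a)–e).", p. 71; (v) having been given up in 4.15: "Conditions (i), (iii) and (iv) are all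
right for the pair `(X', Z')`, but (v) may fail"), it consumes the induction hypothesis exactly
once ("At this point we apply the induction hypothesis", p. 74) and it ends where the text
restarts ("we reduce to the situation described in 4.23 below", p. 75). It is NOT to be cut
again and needs no new named fact: the tree already decomposes it along the printed numbering,
and everything between it and the current leaves is PROVED —

* 4.22 from "At this point" (`DeJong1996PreSemiStablePairToSemiStablePair_holds`,
  `LiuFlatIntegral.lean`: the induction hypothesis for `(Y, D)`, pull-back of the family, Liu
  2002, 4.3.8, and 4.4), glued by `DeJong1996MultisectionToSemiStablePair.of_toPre`
  (`AlterationsPreSemiStableToSemiStableProofs.lean`);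
* 4.15 (strict transforms, `DeJong1996StrictTransform_holds`) and 4.16 (Galois normalisation,
  `DeJong1996GaloisNormalization_holds`, whence `DeJong1996SectionsReduction_holds`,
  `GaloisNormalizationHolds.lean`), glued by
  `DeJong1996MultisectionToPreSemiStablePair.of_sections_of_toPre` (`AlterationsSections.lean`);
* 4.17 up to the moduli input (`DeJong1996StableModelReduction.of_stableExtension`,
  `AlterationsStrictTransformConsequences.lean`) and 4.18–4.21 with 4.22 up to "At this point"
  up to the flattening input (`DeJong1996ModelExtensionReduction.of_stacks081R`,
  `AlterationsRationalMapExtensionProofs.lean`: the graph closure, the three-point Lemma 4.20,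
  Serre's criterion, 2.18–2.19), glued by
  `DeJong1996SectionsToPreSemiStablePair.of_stableModel_of_extensionReduction`
  (`AlterationsModelExtension.lean`).

Hence the declarations below: **`DeJong1996MultisectionToSemiStablePair` (and its first factor
`DeJong1996MultisectionToPreSemiStablePair`, 4.15–4.22a) from the TWO named facts still open
below it**, both existing declarations with their own locators and both theories of their own —
`DeJong1996StableExtension` (4.17 with 2.24: the stable extension over a generically étale
projective alteration of the base through the projective level-`ℓ` moduli scheme `ℓM̄_{g,n}` of
stable `n`-pointed curves, `AlterationsStableModelParts.lean`) and `Stacks081R` (Raynaud–Gruson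
1971, Thm. 5.2.2 = Stacks 081R, flattening by a `U`-admissible blow-up, behind de Jong's 2.19,
`StrictTransformFlattening.lean`). The discharge `DeJong1996MultisectionToSemiStablePair_holds` is
literally `DeJong1996MultisectionToSemiStablePair.of_openLeaves` applied to the two discharges
once they land; it cannot live in `AlterationsMultisection.lean` itself (every file used here
imports that one), so it belongs in this leaf file or a sibling of it. For the parent block
4.13–4.22 (`DeJong1996FibrationToSemiStablePair`, `AlterationsThreeBlocks.lean`) the same two
leaves and the hyperplane multisection of the proof of Lemma 4.13 (`DeJong1996MultisectionHyperplane`)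
suffice (`DeJong1996FibrationToSemiStablePair.of_openLeaves`; compare
`DeJong1996FibrationToSemiStablePair.of_printedLeaves` of `AlterationsStrongAlgClosedLeaves.lean`,
written when 4.16 and 4.18–4.21 were still open).

## Sources

* A. J. de Jong, *Smoothness, semi-stability and alterations*, Publ. Math. IHÉS 83 (1996) 51–93:
  4.15–4.22 (pp. 71–75), Situation 4.23 (p. 75); Lemma 4.13–4.14 (pp. 69–70); 2.18–2.20, 2.24
  (pp. 60–62), 4.4, 4.9 (pp. 66–67).
* The Stacks Project, Tag 081R (Raynaud–Gruson 1971, Première partie, Thm. 5.2.2).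
-/

noncomputable section

open CategoryTheory AlgebraicGeometry

namespace Literature.AlgebraicGeometry.Resolution

universe u

/-- **4.15–4.22a (`DeJong1996MultisectionToPreSemiStablePair`) from its two open leaves**: the
stable extension through the level-`ℓ` moduli scheme (4.17/2.24, `DeJong1996StableExtension`) and
Raynaud–Gruson flattening (2.19 in 4.18, `Stacks081R`); 4.15, 4.16, the three-point lemma
4.18–4.21 and 4.22 up to "At this point" are proved in the tree.
[cite: DeJong1996, 4.15–4.22, pp. 71–74] -/
theorem DeJong1996MultisectionToPreSemiStablePair.of_openLeaves
    (h17 : DeJong1996StableExtension.{u}) (h081R : Stacks081R.{u}) :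
    DeJong1996MultisectionToPreSemiStablePair.{u} :=
  DeJong1996MultisectionToPreSemiStablePair.of_sections_of_toPre DeJong1996SectionsReduction_holds
    (DeJong1996SectionsToPreSemiStablePair.of_stableModel_of_extensionReduction
      (DeJong1996StableModelReduction.of_stableExtension h17)
      (DeJong1996ModelExtensionReduction.of_stacks081R h081R))

/-- **4.15–4.22 (`DeJong1996MultisectionToSemiStablePair`) from its two open leaves**
`DeJong1996StableExtension` (4.17/2.24) and `Stacks081R` (2.19), the second half of 4.22 being
proved (`DeJong1996PreSemiStablePairToSemiStablePair_holds`). The discharge of the fact is this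
term fed with the two discharges. [cite: DeJong1996, 4.15–4.22, pp. 71–75] -/
theorem DeJong1996MultisectionToSemiStablePair.of_openLeaves
    (h17 : DeJong1996StableExtension.{u}) (h081R : Stacks081R.{u}) :
    DeJong1996MultisectionToSemiStablePair.{u} :=
  DeJong1996MultisectionToSemiStablePair.of_toPre
    (DeJong1996MultisectionToPreSemiStablePair.of_openLeaves h17 h081R)

/-- **4.13–4.22 (`DeJong1996FibrationToSemiStablePair`) from its three open leaves**: the
hyperplane multisection of the proof of Lemma 4.13 (`DeJong1996MultisectionHyperplane`; the
étale-neighbourhood and generically-étale parts of 4.13 and the bookkeeping of 4.14 are proved),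
`DeJong1996StableExtension` and `Stacks081R`. [cite: DeJong1996, 4.13–4.22, pp. 69–75] -/
theorem DeJong1996FibrationToSemiStablePair.of_openLeaves
    (h13 : DeJong1996MultisectionHyperplane.{u}) (h17 : DeJong1996StableExtension.{u})
    (h081R : Stacks081R.{u}) : DeJong1996FibrationToSemiStablePair.{u} :=
  DeJong1996FibrationToSemiStablePair.of_multisectionLocal_of_toSemiStablePair
    (DeJong1996MultisectionLocal.of_hyperplane h13)
    (DeJong1996MultisectionToSemiStablePair.of_openLeaves h17 h081R)

end Literature.AlgebraicGeometry.Resolution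

end
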